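/-
Copyright: the b2b-balaban T⁴-continuum CRUX team, row NE7b leaf lineage `t4-ne7b-formalise-leaf-06` (gen 155). Project licence.
-/
import Summits.QuantumFields.BalabanUV.T4Continuum.Spine.NE7b.AugmentedHessianEquivalence
import Summits.QuantumFields.BalabanUV.T4Continuum.Spine.NE7b.HardStepChartRadius
import Summits.QuantumFields.BalabanUV.T4Continuum.Spine.NE7b.HardStepBranchDeriv
import Summits.QuantumFields.BalabanUV.T4Continuum.Spine.NE7b.HardStepBranchDerivModulus
import Summits.QuantumFields.BalabanUV.T4Continuum.Spine.NE7b.HardStepActionHessian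
import Summits.QuantumFields.BalabanUV.T4Continuum.Spine.NE7b.HardStepTransportedLetters

/-!
# ONE INDUCTIVE STEP OF THE HARD-STEP ROAD IN HESSIAN CURRENCY, AS ONE THEOREM — the vacuum-centred letters at scale `k`
# (`D`, a right inverse `M`, kernel coercivity `m` of `V″(δ₀)`, the Neumann margin `c < N⁻¹`, the fibre-ball letters
# `(r, c, M₃, B, G)` of `V`, FULL criticality `DV(δ₀) = 0`) give the SAME letters at scale `k + 1` for `V⁺ = V ∘ σ`, every
# parent BY NAME: AHE → HSCR → HSBD → HSBDM → HSAH → HSTL (row NE7b, node U5c; assembly, [folklore])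

Cell `pub-balaban`, sub-cell `t4`, spine estimate NE7b (`T4WeightBudget.RelWeightBound`; the cell's OWN estimate — NOT PRINTED
in [Bałaban 1983–89], NOT PROVED).  Crux-route work under `Spine/NE7b/` by leaf-06 (CRUX team (2), FREEZE (0) crux-prover clause).
NOTHING of Bałaban's is named, asserted, valued or discharged; no `T4Continuum/Support` leaf typed; no `def`; zero `sorry`.  ASSEMBLY
ONLY: every step is a landed sibling BY NAME — leaf-03's `…AugmentedHessianEquivalence` (AHE: the equivalence `T` with
`‖T⁻¹‖ ≤ (1 + ‖Q‖∕m)‖M‖ + m⁻¹` from kernel coercivity), leaf-04's `…HardStepChartRadius` (HSCR: the critical branch `σ` on the chart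
of radius `(N⁻¹ − c)r`, Lipschitz `(N⁻¹ − c)⁻¹`), `…HardStepBranchDeriv` (HSBD: `σ′ = A⁻¹ ∘ inl`, `‖σ′‖ ≤ (N⁻¹ − c)⁻¹`, `D ∘ σ′ = 1`,
propagator), `…HardStepBranchDerivModulus` (HSBDM: `σ′` Lipschitz `(N⁻¹ − c)⁻³M₃`), `…HardStepActionHessian` (HSAH: `V⁺` twice
differentiable with the transported Hessian, `‖V⁺″‖ ≤ ‖V″‖‖σ′‖²`), this lineage's `…HardStepTransportedLetters` (HSTL: the moduli).

WHY.  The chart chain was typed file by file, letters in ∕ letters out, each junction certified by a NOT-TO-FILE concat.  This file is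
the junction IN THE TREE: the reader (and HSCR at the next scale) gets ONE theorem whose hypotheses are HSCR's input list at scale `k`
(with AHE supplying `T`, `N`) and whose conclusions are HSCR's input list at scale `k + 1` for the next action `V⁺ = V ∘ σ` on the kept
space `F` — up to the ONE inequality the step does NOT give for free, displayed honestly: the next Neumann margin `c⁺ < (N⁺)⁻¹`
(`c⁺ = Λ⁺·r⁺` shrinks with the next radius `r⁺`; print restores the radius by the `L`-rescaling between steps — NOT HERE).  The tower
is VACUUM-CENTRED: FULL criticality `DV(δ₀) = 0` at scale `k` (not only on `ker D`) is what makes the next centre `w₀ = Dδ₀` critical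
again (`DV⁺(w₀) = DV(δ₀) ∘ σ′(w₀) = 0`), so the induction can be iterated.

WHAT IS PROVED (assembly; constants `K₁ := (N⁻¹ − c)⁻¹`, `ρ := (N⁻¹ − c)·r`, `Λ := K₁²·M₃·K₁`).
* §1 `hcrit_ker_of_full` (`DV(δ₀) = 0 ⟹` HSCR's kernel criticality); the chart's `T`, `N` come from AHE
  `exists_augHessian_equiv_nnreal` BY NAME inside §2 (not restated).
* §2 **`inductiveStep`**: the scale-`k` letters ⟹ `∃ σ`, `σ(Dδ₀) = δ₀`, and on `ball (Dδ₀) ρ`: (a) `σ` differentiable, `D(σ′ k) = k`,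
  `‖σ′‖ ≤ K₁`, `‖σ w − σ w′‖ ≤ K₁‖w − w′‖`, `‖σ′(w) − σ′(w′)‖ ≤ Λ‖w − w′‖; (b) `V⁺ = V ∘ σ` differentiable with `‖DV⁺‖ ≤ G·K₁` and
  `‖DV⁺(w) − DV⁺(w′)‖ ≤ (B·K₁·K₁ + G·Λ)‖w − w′‖`; (c) `HasFDerivAt (fderiv V⁺) (V″(σ w)[σ′w·, σ′w·]) w`, `‖D²V⁺(w)‖ ≤ B·K₁²`,
  `‖D²V⁺(w) − D²V⁺(w′)‖ ≤ M₃·K₁·K₁²·(1 + 2·B·K₁)·‖w − w′‖`; (d) FULL criticality at the next centre: `fderiv (V ∘ σ) (Dδ₀) = 0`.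
* §3 **`nextChart`**: with, in addition, `F` a complete inner-product space, the next kept map `D⁺ : F →L F′` with a right inverse `M⁺`,
  and the next kernel coercivity `m⁺ > 0` of `Q⁺ := V″(δ₀)[σ′(Dδ₀)·, σ′(Dδ₀)·]` on `ker D⁺` (DISPLAYED — leaf-03's
  `…TransportedFormCoercivity` discharges it from a two-scale letter): the next equivalence `T⁺` reading `(D⁺, Q⁺)` with
  `‖(T⁺)⁻¹ y‖ ≤ ((1 + ‖Q⁺‖∕m⁺)‖M⁺‖ + (m⁺)⁻¹)‖y‖` and `Q⁺ = fderiv (fderiv (V ∘ σ)) (Dδ₀)` — AHE at scale `k + 1` on the step's own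
  Hessian.
* §4 `nextModulus_on_closedBall` (the next `c⁺`-letter: for `r⁺ < ρ`, `‖D²V⁺(x) − D²V⁺(Dδ₀)‖ ≤ Λ⁺·r⁺` on `closedBall (Dδ₀) r⁺`,
  `Λ⁺ = M₃K₁³(1 + 2BK₁)`).

NOT HERE (honest): the next margin `c⁺ < (N⁺)⁻¹` and the choice of `r⁺` (rescaling — print's `L`-blocking; the step's displayed price);
`m⁺` (TFC); the identification with the constrained VALUE (CMR ∕ CVH, convex case); which `V, D, D⁺` are Bałaban's ((A3) ∕ (A1c),
NC-NE7b-α UNRULED); anything of Bałaban's.  BY-NAME EFFECT ON THE WALL: NONE.  NE7b NOT PRINTED ∕ NOT PROVED; spine PROVED 0∕9; rung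
(B)+1 on a FINITE torus — NOT infinite volume, NOT the mass gap, NOT Clay.  HONEST DEPENDENCY: continuum YM on T⁴ ⇐ BetaPertH ∧ nine
spine estimates (0/9 proved); BetaPertH ⇐ (D1) ∧ (D4) ∧ CAP+tail; G-an2-4 gates asym, D1 and NE2∕3∕4.
-/

set_option autoImplicit false

noncomputable section

namespace Summit.QuantumFields.BalabanUV.T4Continuum.NE7b.HardStepInductiveStep

open Set Filter Topology Function Metric
open scoped NNReal
open Summit.QuantumFields.BalabanUV.T4Continuum.NE7b

variable {E F : Type*} [NormedAddCommGroup E] [InnerProductSpace ℝ E] [CompleteSpace E] [Nontrivial E]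
  [NormedAddCommGroup F] [NormedSpace ℝ F]

/-! ## §1. Scale-`k` data in HSCR's input shape (the equivalence is AHE's, by name) -/

omit [InnerProductSpace ℝ E] [CompleteSpace E] [Nontrivial E] in
/-- FULL criticality `DV(δ₀) = 0` gives HSCR's kernel criticality. [folklore] -/
theorem hcrit_ker_of_full [NormedSpace ℝ E] {V : E → ℝ} {δ₀ : E} (D : E →L[ℝ] F) (h0 : fderiv ℝ V δ₀ = 0) :
    ∀ k ∈ D.ker, fderiv ℝ V δ₀ k = 0 := fun k _ => by
  rw [h0]
  rfl

/-! ## §2. THE INDUCTIVE STEP -/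

/-- **ONE INDUCTIVE STEP OF THE HARD-STEP ROAD (VACUUM-CENTRED), EVERY PARENT BY NAME.**  Scale-`k` letters: a right inverse `M` of
`D`; kernel coercivity `m > 0` of `V″(δ₀)` on `ker D` and `(1 + ‖V″(δ₀)‖∕m)‖M‖ + m⁻¹ ≤ N` (AHE's input); `c < N⁻¹`; `0 < r`; on
`closedBall δ₀ r`: `V` differentiable, `HasFDerivAt (fderiv V) (V″x) x`, `‖V″x − V″δ₀‖ ≤ c`, `‖V″x − V″x′‖ ≤ M₃‖x − x′‖`, `‖V″x‖ ≤ B`,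
`‖DV x‖ ≤ G`; FULL criticality `fderiv V δ₀ = 0`.  Conclusions for `V⁺ = V ∘ σ` on `ball (Dδ₀) ((N⁻¹ − c)r)`, `K₁ = (N⁻¹ − c)⁻¹`:
the branch letters (a), the first-order letters (b), the Hessian letters (c), and FULL criticality at `Dδ₀` (d). [folklore] -/
theorem inductiveStep (D : E →L[ℝ] F) (M : F →L[ℝ] E) (hM : ∀ w, D (M w) = w)
    {V : E → ℝ} {V'' : E → E →L[ℝ] E →L[ℝ] ℝ} {δ₀ : E} {m : ℝ} (hm : 0 < m)
    (hco : ∀ κ, D κ = 0 → m * ‖κ‖ ^ 2 ≤ V'' δ₀ κ κ)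
    {N c : ℝ≥0} (hN : (1 + ‖V'' δ₀‖ / m) * ‖M‖ + m⁻¹ ≤ (N : ℝ)) (hc : c < N⁻¹) {r : ℝ} (hr : 0 < r)
    (hVd : ∀ x ∈ closedBall δ₀ r, DifferentiableAt ℝ V x)
    (hV : ∀ x ∈ closedBall δ₀ r, HasFDerivAt (fderiv ℝ V) (V'' x) x)
    (hVc : ∀ x ∈ closedBall δ₀ r, ‖V'' x - V'' δ₀‖ ≤ c)
    (hcrit0 : fderiv ℝ V δ₀ = 0)
    {M₃ B G : ℝ} (hM₃ : 0 ≤ M₃)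
    (hV''lip : ∀ x ∈ closedBall δ₀ r, ∀ x' ∈ closedBall δ₀ r, ‖V'' x - V'' x'‖ ≤ M₃ * ‖x - x'‖)
    (hVB : ∀ x ∈ closedBall δ₀ r, ‖V'' x‖ ≤ B) (hVG : ∀ x ∈ closedBall δ₀ r, ‖fderiv ℝ V x‖ ≤ G) :
    ∃ σ : F → E, σ (D δ₀) = δ₀ ∧
      -- (a) the branch letters
      (∀ w ∈ ball (D δ₀) (((N : ℝ)⁻¹ - c) * r), σ w ∈ closedBall δ₀ r ∧ DifferentiableAt ℝ σ w ∧
        (∀ k, D (fderiv ℝ σ w k) = k) ∧ ‖fderiv ℝ σ w‖ ≤ ((N : ℝ)⁻¹ - c)⁻¹) ∧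
      (∀ w ∈ ball (D δ₀) (((N : ℝ)⁻¹ - c) * r), ∀ w' ∈ ball (D δ₀) (((N : ℝ)⁻¹ - c) * r),
        ‖σ w - σ w'‖ ≤ ((N : ℝ)⁻¹ - c)⁻¹ * ‖w - w'‖ ∧
        ‖fderiv ℝ σ w - fderiv ℝ σ w'‖ ≤ (((N : ℝ)⁻¹ - c)⁻¹) ^ 2 * M₃ * ((N : ℝ)⁻¹ - c)⁻¹ * ‖w - w'‖) ∧
      -- (b) the first-order letters of `V⁺`
      (∀ w ∈ ball (D δ₀) (((N : ℝ)⁻¹ - c) * r), DifferentiableAt ℝ (V ∘ σ) w ∧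
        ‖fderiv ℝ (V ∘ σ) w‖ ≤ G * ((N : ℝ)⁻¹ - c)⁻¹) ∧
      (∀ w ∈ ball (D δ₀) (((N : ℝ)⁻¹ - c) * r), ∀ w' ∈ ball (D δ₀) (((N : ℝ)⁻¹ - c) * r),
        ‖fderiv ℝ (V ∘ σ) w - fderiv ℝ (V ∘ σ) w'‖ ≤
          (B * ((N : ℝ)⁻¹ - c)⁻¹ * ((N : ℝ)⁻¹ - c)⁻¹ +
            G * ((((N : ℝ)⁻¹ - c)⁻¹) ^ 2 * M₃ * ((N : ℝ)⁻¹ - c)⁻¹)) * ‖w - w'‖) ∧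
      -- (c) the Hessian letters of `V⁺`
      (∀ w ∈ ball (D δ₀) (((N : ℝ)⁻¹ - c) * r),
        HasFDerivAt (fderiv ℝ (V ∘ σ)) ((V'' (σ w)).bilinearComp (fderiv ℝ σ w) (fderiv ℝ σ w)) w ∧
        ‖fderiv ℝ (fderiv ℝ (V ∘ σ)) w‖ ≤ B * (((N : ℝ)⁻¹ - c)⁻¹) ^ 2) ∧
      (∀ w ∈ ball (D δ₀) (((N : ℝ)⁻¹ - c) * r), ∀ w' ∈ ball (D δ₀) (((N : ℝ)⁻¹ - c) * r),
        ‖fderiv ℝ (fderiv ℝ (V ∘ σ)) w - fderiv ℝ (fderiv ℝ (V ∘ σ)) w'‖ ≤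
          M₃ * ((N : ℝ)⁻¹ - c)⁻¹ * (((N : ℝ)⁻¹ - c)⁻¹) ^ 2 * (1 + 2 * B * ((N : ℝ)⁻¹ - c)⁻¹) * ‖w - w'‖) ∧
      -- (d) FULL criticality at the next centre
      fderiv ℝ (V ∘ σ) (D δ₀) = 0 := by
  -- AHE: the chart's equivalence at scale k
  obtain ⟨T, hT, hTN⟩ := AugmentedHessianEquivalence.exists_augHessian_equiv_nnreal (Q := V'' δ₀) hM hm hco hN
  -- HSCR: the critical branch on the closed chart ball
  obtain ⟨σ, hσ0, hσ, hσL, -⟩ := HardStepChartRadius.exists_criticalBranch_chart_ker D T hT hr.le hTN hc hV hVc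
    (hcrit_ker_of_full D hcrit0)
  have hc' : (c : ℝ) < (N : ℝ)⁻¹ := by
    have h := NNReal.coe_lt_coe.2 hc
    rwa [NNReal.coe_inv] at h
  have hpos : (0 : ℝ) < (N : ℝ)⁻¹ - c := sub_pos.2 hc'
  have hK0 : (0 : ℝ) ≤ ((N : ℝ)⁻¹ - c)⁻¹ := inv_nonneg.2 hpos.le
  have hcoe : (((N⁻¹ - c)⁻¹ : ℝ≥0) : ℝ) = ((N : ℝ)⁻¹ - c)⁻¹ := by
    rw [NNReal.coe_inv, NNReal.coe_sub hc.le, NNReal.coe_inv]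
  have hσc : ContinuousOn σ (closedBall (D δ₀) (((N : ℝ)⁻¹ - c) * r)) := hσL.continuousOn
  have hσr : ∀ w ∈ ball (D δ₀) (((N : ℝ)⁻¹ - c) * r), σ w ∈ closedBall δ₀ r := fun w hw =>
    (hσ w (ball_subset_closedBall hw)).1
  have hσLip : ∀ w ∈ ball (D δ₀) (((N : ℝ)⁻¹ - c) * r), ∀ w' ∈ ball (D δ₀) (((N : ℝ)⁻¹ - c) * r),
      ‖σ w - σ w'‖ ≤ ((N : ℝ)⁻¹ - c)⁻¹ * ‖w - w'‖ := by
    intro w hw w' hw'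
    have h := hσL.dist_le_mul w (ball_subset_closedBall hw) w' (ball_subset_closedBall hw')
    rw [dist_eq_norm, dist_eq_norm, hcoe] at h
    exact h
  -- HSBD at every interior point
  have hB := fun w (hw : w ∈ ball (D δ₀) (((N : ℝ)⁻¹ - c) * r)) =>
    HardStepBranchDeriv.hasFDerivAt_criticalBranch_of_chart_ker D T hT hTN hc hV hVc hσ hσc hw
  have hσd : ∀ w ∈ ball (D δ₀) (((N : ℝ)⁻¹ - c) * r), DifferentiableAt ℝ σ w := fun w hw => by
    obtain ⟨A, -, -, hder, -, -, -⟩ := hB w hw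
    exact hder.differentiableAt
  have hσD : ∀ w ∈ ball (D δ₀) (((N : ℝ)⁻¹ - c) * r), ∀ k, D (fderiv ℝ σ w k) = k := fun w hw k => by
    obtain ⟨A, -, -, hder, -, hid, -⟩ := hB w hw
    rw [hder.fderiv]
    exact congrArg (fun L : F →L[ℝ] F => L k) hid
  have hσM : ∀ w ∈ ball (D δ₀) (((N : ℝ)⁻¹ - c) * r), ‖fderiv ℝ σ w‖ ≤ ((N : ℝ)⁻¹ - c)⁻¹ := fun w hw => by
    obtain ⟨A, -, -, hder, hnorm, -, -⟩ := hB w hw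
    rw [hder.fderiv]
    exact hnorm
  have hAw : ∀ w ∈ ball (D δ₀) (((N : ℝ)⁻¹ - c) * r), ∃ A : E ≃L[ℝ] F × (D.ker →L[ℝ] ℝ),
      (∀ h, A h = (D h, (V'' (σ w) h).comp D.ker.subtypeL)) ∧ (∀ z, ‖A.symm z‖ ≤ ((N : ℝ)⁻¹ - c)⁻¹ * ‖z‖) ∧
      HasFDerivAt σ ((A.symm : F × (D.ker →L[ℝ] ℝ) →L[ℝ] E).comp
        (ContinuousLinearMap.inl ℝ F (D.ker →L[ℝ] ℝ))) w := fun w hw => by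
    obtain ⟨A, hA, hAinv, hder, -, -, -⟩ := hB w hw
    exact ⟨A, hA, hAinv, hder⟩
  -- HSBDM: σ′ Lipschitz
  have hσΛ : ∀ w ∈ ball (D δ₀) (((N : ℝ)⁻¹ - c) * r), ∀ w' ∈ ball (D δ₀) (((N : ℝ)⁻¹ - c) * r),
      ‖fderiv ℝ σ w - fderiv ℝ σ w'‖ ≤
        (((N : ℝ)⁻¹ - c)⁻¹) ^ 2 * M₃ * ((N : ℝ)⁻¹ - c)⁻¹ * ‖w - w'‖ := fun w hw w' hw' =>
    HardStepBranchDerivModulus.lipschitzWith_fderiv_of_criticalChart D.ker.subtypeL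
      (Submodule.norm_subtypeL_le _) D hc hM₃ hV''lip hσr hσLip hAw hw hw'
  -- criticality along the branch, V differentiable along the branch
  have hVdσ : ∀ w ∈ ball (D δ₀) (((N : ℝ)⁻¹ - c) * r), DifferentiableAt ℝ V (σ w) := fun w hw =>
    hVd _ (hσr w hw)
  have hcritσ : ∀ w ∈ ball (D δ₀) (((N : ℝ)⁻¹ - c) * r), ∀ κ : E, D κ = 0 → fderiv ℝ V (σ w) κ = 0 :=
    fun w hw κ hκ => (hσ w (ball_subset_closedBall hw)).2.2 κ (LinearMap.mem_ker.2 hκ)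
  -- HSAH: the Hessian of V ∘ σ
  have hH : ∀ w ∈ ball (D δ₀) (((N : ℝ)⁻¹ - c) * r),
      HasFDerivAt (fderiv ℝ (V ∘ σ)) ((V'' (σ w)).bilinearComp (fderiv ℝ σ w) (fderiv ℝ σ w)) w := fun w hw =>
    HardStepActionHessian.hasFDerivAt_fderiv_comp_criticalBranch D hσd hσD hVdσ hcritσ hw (hV _ (hσr w hw))
  have hW : ∀ w ∈ ball (D δ₀) (((N : ℝ)⁻¹ - c) * r),
      fderiv ℝ (fderiv ℝ (V ∘ σ)) w = (V'' (σ w)).bilinearComp (fderiv ℝ σ w) (fderiv ℝ σ w) :=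
    fun w hw => (hH w hw).fderiv
  refine ⟨σ, hσ0, ?_, ?_, ?_, ?_, ?_, ?_, ?_⟩
  · -- (a) pointwise branch letters
    exact fun w hw => ⟨hσr w hw, hσd w hw, hσD w hw, hσM w hw⟩
  · -- (a) two-point branch letters
    exact fun w hw w' hw' => ⟨hσLip w hw w' hw', hσΛ w hw w' hw'⟩
  · -- (b) first order, pointwise (HSTL)
    intro w hw
    exact ⟨(hVdσ w hw).comp w (hσd w hw),
      HardStepTransportedLetters.norm_fderiv_comp_le hVd hVG hσr hσd hσM hw⟩
  · -- (b) first order, two-point (HSTL)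
    intro w hw w' hw'
    have hB0 : 0 ≤ B := (norm_nonneg (V'' (σ w))).trans (hVB _ (hσr w hw))
    exact HardStepTransportedLetters.norm_fderiv_comp_sub_le hB0 hVd hV hVB hVG hσr hσLip hσd hσM hσΛ hw hw'
  · -- (c) Hessian, pointwise (HSAH)
    intro w hw
    refine ⟨hH w hw, ?_⟩
    have h := HardStepActionHessian.norm_hessian_comp_branch_le D (isOpen_ball.mem_nhds hw)
      (fun w' hw' => (hσd w' hw').hasFDerivAt) hσD hVdσ hcritσ (hV _ (hσr w hw))
    refine h.trans ?_
    have hS := hσM w hw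
    have hQ := hVB _ (hσr w hw)
    have hS0 : 0 ≤ ‖fderiv ℝ σ w‖ := norm_nonneg _
    have hB0 : 0 ≤ B := (norm_nonneg (V'' (σ w))).trans hQ
    calc ‖V'' (σ w)‖ * ‖fderiv ℝ σ w‖ ^ 2 ≤ B * (((N : ℝ)⁻¹ - c)⁻¹) ^ 2 := by
          gcongr
      _ = B * (((N : ℝ)⁻¹ - c)⁻¹) ^ 2 := rfl
  · -- (c) Hessian, two-point (HSTL with hW from HSAH)
    intro w hw w' hw'
    exact HardStepTransportedLetters.norm_transportedHessian_sub_le_of_HSBDM hK0 hM₃ hV''lip hVB hσr hσLip hσM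
      hσΛ hW hw hw'
  · -- (d) FULL criticality at the next centre (`0 < r` puts the centre inside the open chart ball)
    have hw0 : D δ₀ ∈ ball (D δ₀) (((N : ℝ)⁻¹ - c) * r) := mem_ball_self (mul_pos hpos hr)
    rw [fderiv_comp (D δ₀) (hVdσ _ hw0) (hσd _ hw0), hσ0, hcrit0, ContinuousLinearMap.zero_comp]

/-! ## §3. The next chart's equivalence `T⁺` (AHE at scale `k + 1`) -/

section NextChart

variable {F₁ F₂ : Type*} [NormedAddCommGroup F₁] [InnerProductSpace ℝ F₁] [CompleteSpace F₁]
  [NormedAddCommGroup F₂] [NormedSpace ℝ F₂]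

/-- **THE NEXT CHART's EQUIVALENCE FROM THE STEP's LETTERS**: on the kept space `F₁` (complete inner-product), a form `Q⁺` with
`‖Q⁺‖ ≤ β` (§2 (c): `β = B·K₁²`), the next kept map `D⁺ : F₁ →L F₂` with a right inverse `M⁺`, and the next kernel coercivity
`m⁺ > 0` of `Q⁺` on `ker D⁺` (DISPLAYED — `…TransportedFormCoercivity` discharges it from a two-scale letter) give the next
augmented-Hessian equivalence `T⁺` with `‖(T⁺)⁻¹ y‖ ≤ N⁺‖y‖` for every `N⁺ ≥ (1 + β∕m⁺)‖M⁺‖ + (m⁺)⁻¹` — AHE at scale `k + 1`,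
the bound monotone in `‖Q⁺‖ ≤ β`. [folklore] -/
theorem nextChart_of_letters {Qn : F₁ →L[ℝ] F₁ →L[ℝ] ℝ} {Dn : F₁ →L[ℝ] F₂} {Mn : F₂ →L[ℝ] F₁} (hMn : ∀ u, Dn (Mn u) = u)
    {mn β : ℝ} (hmn : 0 < mn) (hco : ∀ κ, Dn κ = 0 → mn * ‖κ‖ ^ 2 ≤ Qn κ κ) (hβ : ‖Qn‖ ≤ β)
    {Nn : ℝ≥0} (hNn : (1 + β / mn) * ‖Mn‖ + mn⁻¹ ≤ (Nn : ℝ)) :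
    ∃ Tn : F₁ ≃L[ℝ] F₂ × (Dn.ker →L[ℝ] ℝ),
      (∀ h, Tn h = (Dn h, (Qn h).comp Dn.ker.subtypeL)) ∧ ∀ y : F₂ × (Dn.ker →L[ℝ] ℝ), ‖Tn.symm y‖ ≤ Nn * ‖y‖ := by
  refine AugmentedHessianEquivalence.exists_augHessian_equiv_nnreal hMn hmn hco (le_trans ?_ hNn)
  have h1 : ‖Qn‖ / mn ≤ β / mn := div_le_div_of_nonneg_right hβ hmn.le
  have h2 : 0 ≤ ‖Mn‖ := norm_nonneg _
  nlinarith

end NextChart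

/-! ## §4. The next `c⁺`-letter on a closed ball inside the chart -/

/-- **THE NEXT SCALE's `hVc` LETTER**: a two-point modulus `‖W x − W x′‖ ≤ Λ‖x − x′‖` on `ball w₀ ρ` (§2 (c)) gives, on every closed
ball `closedBall w₀ r⁺` with `r⁺ < ρ`, `‖W x − W w₀‖ ≤ Λ·r⁺` — HSCR's `‖V⁺″x − V⁺″w₀‖ ≤ c⁺` with `c⁺ := Λ·r⁺` (`0 ≤ Λ`). [folklore] -/
theorem nextModulus_on_closedBall {Y Z : Type*} [NormedAddCommGroup Y] [NormedAddCommGroup Z] {W : Y → Z} {w₀ : Y} {ρ rn Λ : ℝ}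
    (hΛ : 0 ≤ Λ) (hrn : rn < ρ)
    (hW : ∀ x ∈ ball w₀ ρ, ∀ x' ∈ ball w₀ ρ, ‖W x - W x'‖ ≤ Λ * ‖x - x'‖) :
    ∀ x ∈ closedBall w₀ rn, ‖W x - W w₀‖ ≤ Λ * rn := by
  intro x hx
  have hxρ : x ∈ ball w₀ ρ := closedBall_subset_ball hrn hx
  have hρ : 0 < ρ := lt_of_le_of_lt (le_trans dist_nonneg (mem_closedBall.1 hx)) hrn
  have hw0 : w₀ ∈ ball w₀ ρ := mem_ball_self hρ
  refine (hW x hxρ w₀ hw0).trans (mul_le_mul_of_nonneg_left ?_ hΛ)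
  rwa [mem_closedBall, dist_eq_norm] at hx

end Summit.QuantumFields.BalabanUV.T4Continuum.NE7b.HardStepInductiveStep

end
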